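import Summits.ValiantsHypothesis.ValiantsHypothesis.Theorems.LacunarySymmetroidMatrixDescartesFiniteSectorStampCeilingSevenSixA
import Summits.ValiantsHypothesis.ValiantsHypothesis.Theorems.LacunarySymmetroidMatrixDescartesFiniteSectorStampCeilingSevenSixB
import Summits.ValiantsHypothesis.ValiantsHypothesis.Theorems.LacunarySymmetroidMatrixDescartesFiniteSectorStampCeilingSevenSixC
import Summits.ValiantsHypothesis.ValiantsHypothesis.Theorems.LacunarySymmetroidMatrixDescartesFiniteSectorStampCeilingSevenSixD
import Summits.ValiantsHypothesis.ValiantsHypothesis.Theorems.LacunarySymmetroidMatrixDescartesFiniteSectorStampCeilingSevenSixE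
import Summits.ValiantsHypothesis.ValiantsHypothesis.Theorems.LacunarySymmetroidMatrixDescartesFiniteSectorStampCeilingSevenSixF
import Summits.ValiantsHypothesis.ValiantsHypothesis.Theorems.LacunarySymmetroidMatrixDescartesFiniteSectorStampCeilingSevenSixG
import Summits.ValiantsHypothesis.ValiantsHypothesis.Theorems.LacunarySymmetroidMatrixDescartesFiniteSectorStampCeilingSevenSixH
import Summits.ValiantsHypothesis.ValiantsHypothesis.Theorems.LacunarySymmetroidMatrixDescartesFiniteSectorStampCeilingSevenSixI
import Summits.ValiantsHypothesis.ValiantsHypothesis.Theorems.LacunarySymmetroidMatrixDescartesFiniteSectorStampCeilingSevenSixJ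
import Summits.ValiantsHypothesis.ValiantsHypothesis.Theorems.LacunarySymmetroidMatrixDescartesFiniteSectorStampCeilingSevenSixK
import Summits.ValiantsHypothesis.ValiantsHypothesis.Theorems.LacunarySymmetroidMatrixDescartesFiniteSectorStampCeilingSevenSixL
import Summits.ValiantsHypothesis.ValiantsHypothesis.Theorems.LacunarySymmetroidMatrixDescartesFiniteSectorStampCeilingSevenSixM
import Summits.ValiantsHypothesis.ValiantsHypothesis.Theorems.LacunarySymmetroidMatrixDescartesFiniteSectorSumMasksHigherTwo
import Summits.ValiantsHypothesis.ValiantsHypothesis.Theorems.LacunarySymmetroidMatrixDescartesFiniteSectorSectorCeilingMTwoKNineO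

/-!
# `MatrixDescartes` — line «stamp»: the STAMP CEILING `ν(7,6) ≤ 345 = n(7,5)` (kernel) — `StampLawAt 7 6 345`

HONEST FRAMING.  Object-search cell `pub-symmetroid`, seat val-sym-door-p5 g9 (generator of val-sym-door-p5 g8 VERBATIM, m-tables extended to m ≤ 11).  HELPER of the crux item `stmt-ValiantsHypothesis-18050` with NO closure claim.
T3 (`mem_sumset_of_fullPos`) makes every `r ≤ deg` of a full-positive-rooted symmetric `7 × 7` half-pencil with `6` terms an `7`-fold sum of exponents; the
values `0, 1` occur, and the capped, padded, sorted value set must cover `[0, deg]`; the finite core — no `5` denominations with `7` stamps cover `[0, 346]`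
(`n(7,5) = 345`) — has 221516 live prefixes and is decided in the kernel in SLICES by the third and fourth values `(a,b)` (`a ≤ 8`, `b ≤ 7a + 1` forced by
the cover at `8` and `7a + 1`; dead pairs in that range are refuted by `decide` on the prefix atom): slices in
`…FiniteSectorStampCeilingSevenSixA`, `…FiniteSectorStampCeilingSevenSixB`, `…FiniteSectorStampCeilingSevenSixC`, `…FiniteSectorStampCeilingSevenSixD`, `…FiniteSectorStampCeilingSevenSixE`, `…FiniteSectorStampCeilingSevenSixF`, `…FiniteSectorStampCeilingSevenSixG`, `…FiniteSectorStampCeilingSevenSixH`, `…FiniteSectorStampCeilingSevenSixI`, `…FiniteSectorStampCeilingSevenSixJ`, `…FiniteSectorStampCeilingSevenSixK`, `…FiniteSectorStampCeilingSevenSixL`, `…FiniteSectorStampCeilingSevenSixM` (this file holds the transfer only); `7`-fold sums as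
iterated shift-form bitmasks.  Result: `stampLawAt_seven_six : StampLawAt 7 6 345`.  Located first (exact DFS, this seat): best reach of `5` denominations with `7`
stamps = `345` (e.g. {1,8,11,64,102}).  Nothing here bears on the crux (asymptotic), on the doors, or on `VP ≠ VNP`.
[folklore] Postage-stamp bookkeeping on the proved T3 (Guy UPINT C12; Challis / Mossige tables); no citation is load-bearing.
-/

-- `Summit.ValiantsHypothesis.ValiantsHypothesis.…` repeats a component by the D-0017 layout
-- (single-conjunct summit), which the `dupNamespace` linter flags; the name is mandated.
set_option linter.dupNamespace false

namespace Summit.ValiantsHypothesis.ValiantsHypothesis.Theorems.LacunarySymmetroidMatrixDescartes.FiniteSector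

open scoped BigOperators Matrix
open Polynomial

/-! ## `(7,6)`: `ν(7,6) ≤ n(7,5) = 345` — the transfer -/

set_option maxHeartbeats 1000000 in
/-- **`ν(7,6) ≤ 345 = n(7,5)`** — `StampLawAt 7 6 345`: every full-positive-rooted symmetric `7 × 7` half-pencil determinant with `6` terms has
degree `≤ 345` (T3 ⇒ every `r ≤ deg` is an `7`-fold sum; values `0, 1` forced; capped at `347`, padded, sorted; `a ≤ 8`, `b ≤ 7a + 1`; bitmasks; the slice checks). [folklore] -/
theorem stampLawAt_seven_six : StampLawAt 7 6 345 := by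
  intro d S hS hfull
  by_contra hdeg'
  have hdeg : 345 < (pencil d S).det.natDegree := not_le.mp hdeg'
  have hq : (pencil d S).det ≠ 0 := by
    intro h0
    rw [h0] at hdeg
    simp at hdeg
  have hmem : ∀ r, r ≤ (pencil d S).det.natDegree → ∃ i j k l n o q : Fin 6, d i + d j + d k + d l + d n + d o + d q = r := by
    intro r hr
    have hm := mem_sumset_of_fullPos d S hq hfull hr
    rw [Finset.mem_image] at hm
    obtain ⟨s, -, hs⟩ := hm
    obtain ⟨i, j, k, l, n, o, q, h7⟩ := exists_sum_eq_of_card_seven d (s : Multiset (Fin 6)) s.2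
    exact ⟨i, j, k, l, n, o, q, by omega⟩
  set cv : Fin 6 → ℕ := fun i => min (d i) 347 with hcv
  have hcvd : ∀ i, d i ≤ 346 → cv i = d i := fun i hi => by
    simp only [hcv]
    exact Nat.min_eq_left (by omega)
  have hcvle : ∀ i, cv i ≤ 347 := fun i => Nat.min_le_right _ _
  set V : Finset ℕ := Finset.univ.image cv with hV
  have hcvV : ∀ i, cv i ∈ V := fun i => Finset.mem_image_of_mem cv (Finset.mem_univ i)
  have h0V : 0 ∈ V := by
    obtain ⟨i, j, k, l, n, o, q, hh⟩ := hmem 0 (Nat.zero_le _)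
    have : cv i = 0 := by rw [hcvd i (by omega)]; omega
    exact this ▸ hcvV i
  have h1V : 1 ∈ V := by
    obtain ⟨i, j, k, l, n, o, q, hh⟩ := hmem 1 (by omega)
    have key : ∃ t : Fin 6, d t = 1 := by
      by_contra hne; simp only [not_exists] at hne; have := hne i; have := hne j; have := hne k; have := hne l; have := hne n; have := hne o; have := hne q; omega
    obtain ⟨t, ht⟩ := key
    have : cv t = 1 := by rw [hcvd t (by omega)]; omega
    exact this ▸ hcvV t
  have h1V' : 1 ∈ V.erase 0 := Finset.mem_erase.mpr ⟨by norm_num, h1V⟩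
  set W : Finset ℕ := (V.erase 0).erase 1 with hW
  have hWsub : W ⊆ ((Finset.range 348).erase 0).erase 1 := by
    intro u hu
    rw [hW, Finset.mem_erase, Finset.mem_erase] at hu
    obtain ⟨hu1, hu0, huV⟩ := hu
    rw [hV, Finset.mem_image] at huV
    obtain ⟨i, -, rfl⟩ := huV
    rw [Finset.mem_erase, Finset.mem_erase, Finset.mem_range]
    exact ⟨hu1, hu0, Nat.lt_succ_of_le (hcvle i)⟩
  have hWcard : W.card ≤ 4 := by
    have hVK : V.card ≤ 6 := by
      have := Finset.card_image_le (s := (Finset.univ : Finset (Fin 6))) (f := cv)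
      simpa using this
    have h1 : (V.erase 0).card + 1 = V.card := Finset.card_erase_add_one h0V
    have h2 : W.card + 1 = (V.erase 0).card := by rw [hW]; exact Finset.card_erase_add_one h1V'
    omega
  obtain ⟨W', hWW', hW'sub, hW'card⟩ := Finset.exists_subsuperset_card_eq hWsub hWcard (by
    rw [Finset.card_erase_of_mem (by simp), Finset.card_erase_of_mem (by simp), Finset.card_range]; omega)
  have hVW' : ∀ u ∈ V, u = 0 ∨ u = 1 ∨ u ∈ W' := by
    intro u hu
    by_cases hu0 : u = 0
    · exact Or.inl hu0
    by_cases hu1 : u = 1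
    · exact Or.inr (Or.inl hu1)
    · exact Or.inr (Or.inr (hWW' (by rw [hW, Finset.mem_erase, Finset.mem_erase]; exact ⟨hu1, hu0, hu⟩)))
  have hlmem : ∀ u, u ∈ Finset.sort W' ↔ u ∈ W' := fun u => Finset.mem_sort _
  have hlsort : (Finset.sort W').SortedLT := Finset.sortedLT_sort W'
  have hllen : (Finset.sort W').length = 4 := by rw [Finset.length_sort, hW'card]
  generalize hl : Finset.sort W' = l at hlmem hlsort hllen
  rcases l with _ | ⟨a, _ | ⟨b, _ | ⟨c, _ | ⟨e, _ | ⟨zz, ll⟩⟩⟩⟩⟩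
  all_goals simp only [List.length_cons, List.length_nil] at hllen
  all_goals try omega
  have hmemR : ∀ u, u ∈ [a, b, c, e] → u ∈ List.range 348 := by
    intro u hu
    have hu' : u ∈ W' := (hlmem u).mp hu
    have := hW'sub hu'
    rw [Finset.mem_erase, Finset.mem_erase, Finset.mem_range] at this
    exact List.mem_range.mpr this.2.2
  have hgt1 : ∀ u, u ∈ [a, b, c, e] → 1 < u := by
    intro u hu
    have hu' : u ∈ W' := (hlmem u).mp hu
    have := hW'sub hu'
    rw [Finset.mem_erase, Finset.mem_erase] at this
    omega
  have h1a : 1 < a := hgt1 a (by simp)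
  have hmemP : ∀ r, r ≤ 346 → (∃ i j k l n o q : Fin 6, d i + d j + d k + d l + d n + d o + d q = r) → (∃ x ∈ [0, 1, a, b, c, e], ∃ y ∈ [0, 1, a, b, c, e], ∃ z ∈ [0, 1, a, b, c, e], ∃ w ∈ [0, 1, a, b, c, e], ∃ v ∈ [0, 1, a, b, c, e], ∃ o ∈ [0, 1, a, b, c, e], ∃ t ∈ [0, 1, a, b, c, e], x + y + z + w + v + o + t = r) := by
    rintro r hr ⟨i, j, k, l, n, o, q, hsum⟩
    have hi : cv i = d i := hcvd i (by omega)
    have hj : cv j = d j := hcvd j (by omega)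
    have hk : cv k = d k := hcvd k (by omega)
    have hl : cv l = d l := hcvd l (by omega)
    have hn : cv n = d n := hcvd n (by omega)
    have ho : cv o = d o := hcvd o (by omega)
    have hq : cv q = d q := hcvd q (by omega)
    have hin : ∀ u ∈ V, u ∈ [0, 1, a, b, c, e] := by
      intro u hu
      rcases hVW' u hu with h | h | h
      · rw [h]; simp
      · rw [h]; simp
      · exact List.mem_cons_of_mem _ (List.mem_cons_of_mem _ ((hlmem u).mpr h))
    exact ⟨cv i, hin _ (hcvV i), cv j, hin _ (hcvV j), cv k, hin _ (hcvV k), cv l, hin _ (hcvV l), cv n, hin _ (hcvV n), cv o, hin _ (hcvV o), cv q, hin _ (hcvV q), by rw [hi, hj, hk, hl, hn, ho, hq]; exact hsum⟩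
  have hcovP : ∀ r, r ≤ 346 → (∃ x ∈ [0, 1, a, b, c, e], ∃ y ∈ [0, 1, a, b, c, e], ∃ z ∈ [0, 1, a, b, c, e], ∃ w ∈ [0, 1, a, b, c, e], ∃ v ∈ [0, 1, a, b, c, e], ∃ o ∈ [0, 1, a, b, c, e], ∃ t ∈ [0, 1, a, b, c, e], x + y + z + w + v + o + t = r) := fun r hr => hmemP r hr (hmem r (by omega))
  have hlt1 : a < b := by
    have := hlsort (show (⟨0, by simp⟩ : Fin [a, b, c, e].length) < ⟨1, by simp⟩ from Fin.mk_lt_mk.mpr (by norm_num))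
    simpa using this
  have hlt2 : b < c := by
    have := hlsort (show (⟨1, by simp⟩ : Fin [a, b, c, e].length) < ⟨2, by simp⟩ from Fin.mk_lt_mk.mpr (by norm_num))
    simpa using this
  have hlt3 : c < e := by
    have := hlsort (show (⟨2, by simp⟩ : Fin [a, b, c, e].length) < ⟨3, by simp⟩ from Fin.mk_lt_mk.mpr (by norm_num))
    simpa using this
  -- bound on the third value: `a ≤ 8` (cover at `8`); the fourth value is bounded per `a` below (first missing bit of the explicit mask of `[0, 1, a]`)
  have hrestA : ∀ y ∈ [a, b, c, e], a ≤ y := by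
    intro y hy
    simp only [List.mem_cons, List.mem_nil_iff, or_false] at hy
    omega
  have haM : a ≤ 8 := by
    by_contra hh
    obtain ⟨x, hx, y, hy, z, hz, w, hw, v, hv, o, ho, t, ht, hsum⟩ := memP7_prefix (l₁ := [0, 1]) (l₂ := [a, b, c, e]) hrestA (show 8 < a by omega) (hcovP 8 (by omega))
    simp only [List.mem_cons, List.mem_nil_iff, or_false] at hx hy hz hw hv ho ht
    omega
  have pre2 : (List.foldr (fun x acc => acc ||| (List.foldr (fun x acc => acc ||| (List.foldr (fun x acc => acc ||| (List.foldr (fun x acc => acc ||| (List.foldr (fun x acc => acc ||| (List.foldr (fun x acc => acc ||| (List.foldr (fun y acc => acc ||| 2 ^ y) 0 [0, 1, a]) * 2 ^ x) 0 [0, 1, a]) * 2 ^ x) 0 [0, 1, a]) * 2 ^ x) 0 [0, 1, a]) * 2 ^ x) 0 [0, 1, a]) * 2 ^ x) 0 [0, 1, a]) * 2 ^ x) 0 [0, 1, a] % 2 ^ (min 347 b) = 2 ^ (min 347 b) - 1) := by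
    apply maskFull_of_testBit
    intro r hr
    have hrN : r < 347 := lt_of_lt_of_le hr (min_le_left _ _)
    have hrv : r < b := lt_of_lt_of_le hr (min_le_right _ _)
    have hrest : ∀ y ∈ [b, c, e], b ≤ y := by
      intro y hy
      simp only [List.mem_cons, List.mem_nil_iff, or_false] at hy
      omega
    exact testBit_fold7Shift_of_mem (memP7_prefix (l₁ := [0, 1, a]) (l₂ := [b, c, e]) hrest hrv (hcovP r (by omega)))
  have pre3 : (List.foldr (fun x acc => acc ||| (List.foldr (fun x acc => acc ||| (List.foldr (fun x acc => acc ||| (List.foldr (fun x acc => acc ||| (List.foldr (fun x acc => acc ||| (List.foldr (fun x acc => acc ||| (List.foldr (fun y acc => acc ||| 2 ^ y) 0 [0, 1, a, b]) * 2 ^ x) 0 [0, 1, a, b]) * 2 ^ x) 0 [0, 1, a, b]) * 2 ^ x) 0 [0, 1, a, b]) * 2 ^ x) 0 [0, 1, a, b]) * 2 ^ x) 0 [0, 1, a, b]) * 2 ^ x) 0 [0, 1, a, b] % 2 ^ (min 347 c) = 2 ^ (min 347 c) - 1) := by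
    clear pre2
    apply maskFull_of_testBit
    intro r hr
    have hrN : r < 347 := lt_of_lt_of_le hr (min_le_left _ _)
    have hrv : r < c := lt_of_lt_of_le hr (min_le_right _ _)
    have hrest : ∀ y ∈ [c, e], c ≤ y := by
      intro y hy
      simp only [List.mem_cons, List.mem_nil_iff, or_false] at hy
      omega
    exact testBit_fold7Shift_of_mem (memP7_prefix (l₁ := [0, 1, a, b]) (l₂ := [c, e]) hrest hrv (hcovP r (by omega)))
  have pre4 : (List.foldr (fun x acc => acc ||| (List.foldr (fun x acc => acc ||| (List.foldr (fun x acc => acc ||| (List.foldr (fun x acc => acc ||| (List.foldr (fun x acc => acc ||| (List.foldr (fun x acc => acc ||| (List.foldr (fun y acc => acc ||| 2 ^ y) 0 [0, 1, a, b, c]) * 2 ^ x) 0 [0, 1, a, b, c]) * 2 ^ x) 0 [0, 1, a, b, c]) * 2 ^ x) 0 [0, 1, a, b, c]) * 2 ^ x) 0 [0, 1, a, b, c]) * 2 ^ x) 0 [0, 1, a, b, c]) * 2 ^ x) 0 [0, 1, a, b, c] % 2 ^ (min 347 e) = 2 ^ (min 347 e) - 1) := by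
    clear pre2 pre3
    apply maskFull_of_testBit
    intro r hr
    have hrN : r < 347 := lt_of_lt_of_le hr (min_le_left _ _)
    have hrv : r < e := lt_of_lt_of_le hr (min_le_right _ _)
    have hrest : ∀ y ∈ [e], e ≤ y := by
      intro y hy
      simp only [List.mem_cons, List.mem_nil_iff, or_false] at hy
      omega
    exact testBit_fold7Shift_of_mem (memP7_prefix (l₁ := [0, 1, a, b, c]) (l₂ := [e]) hrest hrv (hcovP r (by omega)))
  have hcovT : (List.foldr (fun x acc => acc ||| (List.foldr (fun x acc => acc ||| (List.foldr (fun x acc => acc ||| (List.foldr (fun x acc => acc ||| (List.foldr (fun x acc => acc ||| (List.foldr (fun x acc => acc ||| (List.foldr (fun y acc => acc ||| 2 ^ y) 0 [0, 1, a, b, c, e]) * 2 ^ x) 0 [0, 1, a, b, c, e]) * 2 ^ x) 0 [0, 1, a, b, c, e]) * 2 ^ x) 0 [0, 1, a, b, c, e]) * 2 ^ x) 0 [0, 1, a, b, c, e]) * 2 ^ x) 0 [0, 1, a, b, c, e]) * 2 ^ x) 0 [0, 1, a, b, c, e] % 2 ^ 347 = 2 ^ 347 - 1) := by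
    clear pre2 pre3 pre4
    exact maskFull_of_testBit (fun r hr => testBit_fold7Shift_of_mem (hcovP r (by omega)))
  interval_cases a
  · -- a = 2: the 7-fold sums of [0, 1, 2] cover [0, 14] and miss 15 ⇒ b ≤ 15
    have hbT : b ≤ 15 := by
      by_contra hh
      exact absurd (testBit_of_maskMod pre2 (show 15 < min 347 b by omega)) (by decide +kernel)
    interval_cases b
    · exact stampCheck_seven_six_s2_3 c (hmemR c (by simp)) ⟨hlt2, pre3⟩ e (hmemR e (by simp)) ⟨hlt3, pre4⟩ hcovT
    · exact stampCheck_seven_six_s2_4 c (hmemR c (by simp)) ⟨hlt2, pre3⟩ e (hmemR e (by simp)) ⟨hlt3, pre4⟩ hcovT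
    · exact stampCheck_seven_six_s2_5 c (hmemR c (by simp)) ⟨hlt2, pre3⟩ e (hmemR e (by simp)) ⟨hlt3, pre4⟩ hcovT
    · exact stampCheck_seven_six_s2_6 c (hmemR c (by simp)) ⟨hlt2, pre3⟩ e (hmemR e (by simp)) ⟨hlt3, pre4⟩ hcovT
    · exact stampCheck_seven_six_s2_7 c (hmemR c (by simp)) ⟨hlt2, pre3⟩ e (hmemR e (by simp)) ⟨hlt3, pre4⟩ hcovT
    · exact stampCheck_seven_six_s2_8 c (hmemR c (by simp)) ⟨hlt2, pre3⟩ e (hmemR e (by simp)) ⟨hlt3, pre4⟩ hcovT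
    · exact stampCheck_seven_six_s2_9 c (hmemR c (by simp)) ⟨hlt2, pre3⟩ e (hmemR e (by simp)) ⟨hlt3, pre4⟩ hcovT
    · exact stampCheck_seven_six_s2_10 c (hmemR c (by simp)) ⟨hlt2, pre3⟩ e (hmemR e (by simp)) ⟨hlt3, pre4⟩ hcovT
    · exact stampCheck_seven_six_s2_11 c (hmemR c (by simp)) ⟨hlt2, pre3⟩ e (hmemR e (by simp)) ⟨hlt3, pre4⟩ hcovT
    · exact stampCheck_seven_six_s2_12 c (hmemR c (by simp)) ⟨hlt2, pre3⟩ e (hmemR e (by simp)) ⟨hlt3, pre4⟩ hcovT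
    · exact stampCheck_seven_six_s2_13 c (hmemR c (by simp)) ⟨hlt2, pre3⟩ e (hmemR e (by simp)) ⟨hlt3, pre4⟩ hcovT
    · exact stampCheck_seven_six_s2_14 c (hmemR c (by simp)) ⟨hlt2, pre3⟩ e (hmemR e (by simp)) ⟨hlt3, pre4⟩ hcovT
    · exact stampCheck_seven_six_s2_15 c (hmemR c (by simp)) ⟨hlt2, pre3⟩ e (hmemR e (by simp)) ⟨hlt3, pre4⟩ hcovT
  · -- a = 3: the 7-fold sums of [0, 1, 3] cover [0, 19] and miss 20 ⇒ b ≤ 20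
    have hbT : b ≤ 20 := by
      by_contra hh
      exact absurd (testBit_of_maskMod pre2 (show 20 < min 347 b by omega)) (by decide +kernel)
    interval_cases b
    · exact stampCheck_seven_six_s3_4 c (hmemR c (by simp)) ⟨hlt2, pre3⟩ e (hmemR e (by simp)) ⟨hlt3, pre4⟩ hcovT
    · exact stampCheck_seven_six_s3_5 c (hmemR c (by simp)) ⟨hlt2, pre3⟩ e (hmemR e (by simp)) ⟨hlt3, pre4⟩ hcovT
    · exact stampCheck_seven_six_s3_6 c (hmemR c (by simp)) ⟨hlt2, pre3⟩ e (hmemR e (by simp)) ⟨hlt3, pre4⟩ hcovT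
    · exact stampCheck_seven_six_s3_7 c (hmemR c (by simp)) ⟨hlt2, pre3⟩ e (hmemR e (by simp)) ⟨hlt3, pre4⟩ hcovT
    · exact stampCheck_seven_six_s3_8 c (hmemR c (by simp)) ⟨hlt2, pre3⟩ e (hmemR e (by simp)) ⟨hlt3, pre4⟩ hcovT
    · exact stampCheck_seven_six_s3_9 c (hmemR c (by simp)) ⟨hlt2, pre3⟩ e (hmemR e (by simp)) ⟨hlt3, pre4⟩ hcovT
    · exact stampCheck_seven_six_s3_10 c (hmemR c (by simp)) ⟨hlt2, pre3⟩ e (hmemR e (by simp)) ⟨hlt3, pre4⟩ hcovT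
    · exact stampCheck_seven_six_s3_11 c (hmemR c (by simp)) ⟨hlt2, pre3⟩ e (hmemR e (by simp)) ⟨hlt3, pre4⟩ hcovT
    · exact stampCheck_seven_six_s3_12 c (hmemR c (by simp)) ⟨hlt2, pre3⟩ e (hmemR e (by simp)) ⟨hlt3, pre4⟩ hcovT
    · exact stampCheck_seven_six_s3_13 c (hmemR c (by simp)) ⟨hlt2, pre3⟩ e (hmemR e (by simp)) ⟨hlt3, pre4⟩ hcovT
    · exact stampCheck_seven_six_s3_14 c (hmemR c (by simp)) ⟨hlt2, pre3⟩ e (hmemR e (by simp)) ⟨hlt3, pre4⟩ hcovT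
    · exact stampCheck_seven_six_s3_15 c (hmemR c (by simp)) ⟨hlt2, pre3⟩ e (hmemR e (by simp)) ⟨hlt3, pre4⟩ hcovT
    · exact stampCheck_seven_six_s3_16 c (hmemR c (by simp)) ⟨hlt2, pre3⟩ e (hmemR e (by simp)) ⟨hlt3, pre4⟩ hcovT
    · exact stampCheck_seven_six_s3_17 c (hmemR c (by simp)) ⟨hlt2, pre3⟩ e (hmemR e (by simp)) ⟨hlt3, pre4⟩ hcovT
    · exact stampCheck_seven_six_s3_18 c (hmemR c (by simp)) ⟨hlt2, pre3⟩ e (hmemR e (by simp)) ⟨hlt3, pre4⟩ hcovT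
    · exact stampCheck_seven_six_s3_19 c (hmemR c (by simp)) ⟨hlt2, pre3⟩ e (hmemR e (by simp)) ⟨hlt3, pre4⟩ hcovT
    · exact stampCheck_seven_six_s3_20 c (hmemR c (by simp)) ⟨hlt2, pre3⟩ e (hmemR e (by simp)) ⟨hlt3, pre4⟩ hcovT
  · -- a = 4: the 7-fold sums of [0, 1, 4] cover [0, 22] and miss 23 ⇒ b ≤ 23
    have hbT : b ≤ 23 := by
      by_contra hh
      exact absurd (testBit_of_maskMod pre2 (show 23 < min 347 b by omega)) (by decide +kernel)
    interval_cases b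
    · exact stampCheck_seven_six_s4_5 c (hmemR c (by simp)) ⟨hlt2, pre3⟩ e (hmemR e (by simp)) ⟨hlt3, pre4⟩ hcovT
    · exact stampCheck_seven_six_s4_6 c (hmemR c (by simp)) ⟨hlt2, pre3⟩ e (hmemR e (by simp)) ⟨hlt3, pre4⟩ hcovT
    · exact stampCheck_seven_six_s4_7 c (hmemR c (by simp)) ⟨hlt2, pre3⟩ e (hmemR e (by simp)) ⟨hlt3, pre4⟩ hcovT
    · exact stampCheck_seven_six_s4_8 c (hmemR c (by simp)) ⟨hlt2, pre3⟩ e (hmemR e (by simp)) ⟨hlt3, pre4⟩ hcovT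
    · exact stampCheck_seven_six_s4_9 c (hmemR c (by simp)) ⟨hlt2, pre3⟩ e (hmemR e (by simp)) ⟨hlt3, pre4⟩ hcovT
    · exact stampCheck_seven_six_s4_10 c (hmemR c (by simp)) ⟨hlt2, pre3⟩ e (hmemR e (by simp)) ⟨hlt3, pre4⟩ hcovT
    · exact stampCheck_seven_six_s4_11 c (hmemR c (by simp)) ⟨hlt2, pre3⟩ e (hmemR e (by simp)) ⟨hlt3, pre4⟩ hcovT
    · exact stampCheck_seven_six_s4_12 c (hmemR c (by simp)) ⟨hlt2, pre3⟩ e (hmemR e (by simp)) ⟨hlt3, pre4⟩ hcovT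
    · exact stampCheck_seven_six_s4_13 c (hmemR c (by simp)) ⟨hlt2, pre3⟩ e (hmemR e (by simp)) ⟨hlt3, pre4⟩ hcovT
    · exact stampCheck_seven_six_s4_14 c (hmemR c (by simp)) ⟨hlt2, pre3⟩ e (hmemR e (by simp)) ⟨hlt3, pre4⟩ hcovT
    · exact stampCheck_seven_six_s4_15 c (hmemR c (by simp)) ⟨hlt2, pre3⟩ e (hmemR e (by simp)) ⟨hlt3, pre4⟩ hcovT
    · exact stampCheck_seven_six_s4_16 c (hmemR c (by simp)) ⟨hlt2, pre3⟩ e (hmemR e (by simp)) ⟨hlt3, pre4⟩ hcovT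
    · exact stampCheck_seven_six_s4_17 c (hmemR c (by simp)) ⟨hlt2, pre3⟩ e (hmemR e (by simp)) ⟨hlt3, pre4⟩ hcovT
    · exact stampCheck_seven_six_s4_18 c (hmemR c (by simp)) ⟨hlt2, pre3⟩ e (hmemR e (by simp)) ⟨hlt3, pre4⟩ hcovT
    · exact stampCheck_seven_six_s4_19 c (hmemR c (by simp)) ⟨hlt2, pre3⟩ e (hmemR e (by simp)) ⟨hlt3, pre4⟩ hcovT
    · exact stampCheck_seven_six_s4_20 c (hmemR c (by simp)) ⟨hlt2, pre3⟩ e (hmemR e (by simp)) ⟨hlt3, pre4⟩ hcovT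
    · exact stampCheck_seven_six_s4_21 c (hmemR c (by simp)) ⟨hlt2, pre3⟩ e (hmemR e (by simp)) ⟨hlt3, pre4⟩ hcovT
    · exact stampCheck_seven_six_s4_22 c (hmemR c (by simp)) ⟨hlt2, pre3⟩ e (hmemR e (by simp)) ⟨hlt3, pre4⟩ hcovT
    · exact stampCheck_seven_six_s4_23 c (hmemR c (by simp)) ⟨hlt2, pre3⟩ e (hmemR e (by simp)) ⟨hlt3, pre4⟩ hcovT
  · -- a = 5: the 7-fold sums of [0, 1, 5] cover [0, 23] and miss 24 ⇒ b ≤ 24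
    have hbT : b ≤ 24 := by
      by_contra hh
      exact absurd (testBit_of_maskMod pre2 (show 24 < min 347 b by omega)) (by decide +kernel)
    interval_cases b
    · exact stampCheck_seven_six_s5_6 c (hmemR c (by simp)) ⟨hlt2, pre3⟩ e (hmemR e (by simp)) ⟨hlt3, pre4⟩ hcovT
    · exact stampCheck_seven_six_s5_7 c (hmemR c (by simp)) ⟨hlt2, pre3⟩ e (hmemR e (by simp)) ⟨hlt3, pre4⟩ hcovT
    · exact stampCheck_seven_six_s5_8 c (hmemR c (by simp)) ⟨hlt2, pre3⟩ e (hmemR e (by simp)) ⟨hlt3, pre4⟩ hcovT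
    · exact stampCheck_seven_six_s5_9 c (hmemR c (by simp)) ⟨hlt2, pre3⟩ e (hmemR e (by simp)) ⟨hlt3, pre4⟩ hcovT
    · exact stampCheck_seven_six_s5_10 c (hmemR c (by simp)) ⟨hlt2, pre3⟩ e (hmemR e (by simp)) ⟨hlt3, pre4⟩ hcovT
    · exact stampCheck_seven_six_s5_11 c (hmemR c (by simp)) ⟨hlt2, pre3⟩ e (hmemR e (by simp)) ⟨hlt3, pre4⟩ hcovT
    · exact stampCheck_seven_six_s5_12 c (hmemR c (by simp)) ⟨hlt2, pre3⟩ e (hmemR e (by simp)) ⟨hlt3, pre4⟩ hcovT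
    · exact stampCheck_seven_six_s5_13 c (hmemR c (by simp)) ⟨hlt2, pre3⟩ e (hmemR e (by simp)) ⟨hlt3, pre4⟩ hcovT
    · exact stampCheck_seven_six_s5_14 c (hmemR c (by simp)) ⟨hlt2, pre3⟩ e (hmemR e (by simp)) ⟨hlt3, pre4⟩ hcovT
    · exact stampCheck_seven_six_s5_15 c (hmemR c (by simp)) ⟨hlt2, pre3⟩ e (hmemR e (by simp)) ⟨hlt3, pre4⟩ hcovT
    · exact stampCheck_seven_six_s5_16 c (hmemR c (by simp)) ⟨hlt2, pre3⟩ e (hmemR e (by simp)) ⟨hlt3, pre4⟩ hcovT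
    · exact stampCheck_seven_six_s5_17 c (hmemR c (by simp)) ⟨hlt2, pre3⟩ e (hmemR e (by simp)) ⟨hlt3, pre4⟩ hcovT
    · exact stampCheck_seven_six_s5_18 c (hmemR c (by simp)) ⟨hlt2, pre3⟩ e (hmemR e (by simp)) ⟨hlt3, pre4⟩ hcovT
    · exact stampCheck_seven_six_s5_19 c (hmemR c (by simp)) ⟨hlt2, pre3⟩ e (hmemR e (by simp)) ⟨hlt3, pre4⟩ hcovT
    · exact stampCheck_seven_six_s5_20 c (hmemR c (by simp)) ⟨hlt2, pre3⟩ e (hmemR e (by simp)) ⟨hlt3, pre4⟩ hcovT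
    · exact stampCheck_seven_six_s5_21 c (hmemR c (by simp)) ⟨hlt2, pre3⟩ e (hmemR e (by simp)) ⟨hlt3, pre4⟩ hcovT
    · exact stampCheck_seven_six_s5_22 c (hmemR c (by simp)) ⟨hlt2, pre3⟩ e (hmemR e (by simp)) ⟨hlt3, pre4⟩ hcovT
    · exact stampCheck_seven_six_s5_23 c (hmemR c (by simp)) ⟨hlt2, pre3⟩ e (hmemR e (by simp)) ⟨hlt3, pre4⟩ hcovT
    · exact stampCheck_seven_six_s5_24 c (hmemR c (by simp)) ⟨hlt2, pre3⟩ e (hmemR e (by simp)) ⟨hlt3, pre4⟩ hcovT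
  · -- a = 6: the 7-fold sums of [0, 1, 6] cover [0, 22] and miss 23 ⇒ b ≤ 23
    have hbT : b ≤ 23 := by
      by_contra hh
      exact absurd (testBit_of_maskMod pre2 (show 23 < min 347 b by omega)) (by decide +kernel)
    interval_cases b
    · exact stampCheck_seven_six_s6_7 c (hmemR c (by simp)) ⟨hlt2, pre3⟩ e (hmemR e (by simp)) ⟨hlt3, pre4⟩ hcovT
    · exact stampCheck_seven_six_s6_8 c (hmemR c (by simp)) ⟨hlt2, pre3⟩ e (hmemR e (by simp)) ⟨hlt3, pre4⟩ hcovT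
    · exact stampCheck_seven_six_s6_9 c (hmemR c (by simp)) ⟨hlt2, pre3⟩ e (hmemR e (by simp)) ⟨hlt3, pre4⟩ hcovT
    · exact stampCheck_seven_six_s6_10 c (hmemR c (by simp)) ⟨hlt2, pre3⟩ e (hmemR e (by simp)) ⟨hlt3, pre4⟩ hcovT
    · exact stampCheck_seven_six_s6_11 c (hmemR c (by simp)) ⟨hlt2, pre3⟩ e (hmemR e (by simp)) ⟨hlt3, pre4⟩ hcovT
    · exact stampCheck_seven_six_s6_12 c (hmemR c (by simp)) ⟨hlt2, pre3⟩ e (hmemR e (by simp)) ⟨hlt3, pre4⟩ hcovT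
    · exact stampCheck_seven_six_s6_13 c (hmemR c (by simp)) ⟨hlt2, pre3⟩ e (hmemR e (by simp)) ⟨hlt3, pre4⟩ hcovT
    · exact stampCheck_seven_six_s6_14 c (hmemR c (by simp)) ⟨hlt2, pre3⟩ e (hmemR e (by simp)) ⟨hlt3, pre4⟩ hcovT
    · exact stampCheck_seven_six_s6_15 c (hmemR c (by simp)) ⟨hlt2, pre3⟩ e (hmemR e (by simp)) ⟨hlt3, pre4⟩ hcovT
    · exact stampCheck_seven_six_s6_16 c (hmemR c (by simp)) ⟨hlt2, pre3⟩ e (hmemR e (by simp)) ⟨hlt3, pre4⟩ hcovT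
    · exact stampCheck_seven_six_s6_17 c (hmemR c (by simp)) ⟨hlt2, pre3⟩ e (hmemR e (by simp)) ⟨hlt3, pre4⟩ hcovT
    · exact stampCheck_seven_six_s6_18 c (hmemR c (by simp)) ⟨hlt2, pre3⟩ e (hmemR e (by simp)) ⟨hlt3, pre4⟩ hcovT
    · exact stampCheck_seven_six_s6_19 c (hmemR c (by simp)) ⟨hlt2, pre3⟩ e (hmemR e (by simp)) ⟨hlt3, pre4⟩ hcovT
    · exact stampCheck_seven_six_s6_20 c (hmemR c (by simp)) ⟨hlt2, pre3⟩ e (hmemR e (by simp)) ⟨hlt3, pre4⟩ hcovT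
    · exact stampCheck_seven_six_s6_21 c (hmemR c (by simp)) ⟨hlt2, pre3⟩ e (hmemR e (by simp)) ⟨hlt3, pre4⟩ hcovT
    · exact stampCheck_seven_six_s6_22 c (hmemR c (by simp)) ⟨hlt2, pre3⟩ e (hmemR e (by simp)) ⟨hlt3, pre4⟩ hcovT
    · exact stampCheck_seven_six_s6_23 c (hmemR c (by simp)) ⟨hlt2, pre3⟩ e (hmemR e (by simp)) ⟨hlt3, pre4⟩ hcovT
  · -- a = 7: the 7-fold sums of [0, 1, 7] cover [0, 19] and miss 20 ⇒ b ≤ 20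
    have hbT : b ≤ 20 := by
      by_contra hh
      exact absurd (testBit_of_maskMod pre2 (show 20 < min 347 b by omega)) (by decide +kernel)
    interval_cases b
    · exact stampCheck_seven_six_s7_8 c (hmemR c (by simp)) ⟨hlt2, pre3⟩ e (hmemR e (by simp)) ⟨hlt3, pre4⟩ hcovT
    · exact stampCheck_seven_six_s7_9 c (hmemR c (by simp)) ⟨hlt2, pre3⟩ e (hmemR e (by simp)) ⟨hlt3, pre4⟩ hcovT
    · exact stampCheck_seven_six_s7_10 c (hmemR c (by simp)) ⟨hlt2, pre3⟩ e (hmemR e (by simp)) ⟨hlt3, pre4⟩ hcovT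
    · exact stampCheck_seven_six_s7_11 c (hmemR c (by simp)) ⟨hlt2, pre3⟩ e (hmemR e (by simp)) ⟨hlt3, pre4⟩ hcovT
    · exact stampCheck_seven_six_s7_12 c (hmemR c (by simp)) ⟨hlt2, pre3⟩ e (hmemR e (by simp)) ⟨hlt3, pre4⟩ hcovT
    · exact stampCheck_seven_six_s7_13 c (hmemR c (by simp)) ⟨hlt2, pre3⟩ e (hmemR e (by simp)) ⟨hlt3, pre4⟩ hcovT
    · exact stampCheck_seven_six_s7_14 c (hmemR c (by simp)) ⟨hlt2, pre3⟩ e (hmemR e (by simp)) ⟨hlt3, pre4⟩ hcovT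
    · exact stampCheck_seven_six_s7_15 c (hmemR c (by simp)) ⟨hlt2, pre3⟩ e (hmemR e (by simp)) ⟨hlt3, pre4⟩ hcovT
    · exact stampCheck_seven_six_s7_16 c (hmemR c (by simp)) ⟨hlt2, pre3⟩ e (hmemR e (by simp)) ⟨hlt3, pre4⟩ hcovT
    · exact stampCheck_seven_six_s7_17 c (hmemR c (by simp)) ⟨hlt2, pre3⟩ e (hmemR e (by simp)) ⟨hlt3, pre4⟩ hcovT
    · exact stampCheck_seven_six_s7_18 c (hmemR c (by simp)) ⟨hlt2, pre3⟩ e (hmemR e (by simp)) ⟨hlt3, pre4⟩ hcovT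
    · exact stampCheck_seven_six_s7_19 c (hmemR c (by simp)) ⟨hlt2, pre3⟩ e (hmemR e (by simp)) ⟨hlt3, pre4⟩ hcovT
    · exact stampCheck_seven_six_s7_20 c (hmemR c (by simp)) ⟨hlt2, pre3⟩ e (hmemR e (by simp)) ⟨hlt3, pre4⟩ hcovT
  · -- a = 8: the 7-fold sums of [0, 1, 8] cover [0, 14] and miss 15 ⇒ b ≤ 15
    have hbT : b ≤ 15 := by
      by_contra hh
      exact absurd (testBit_of_maskMod pre2 (show 15 < min 347 b by omega)) (by decide +kernel)
    interval_cases b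
    · exact stampCheck_seven_six_s8_9 c (hmemR c (by simp)) ⟨hlt2, pre3⟩ e (hmemR e (by simp)) ⟨hlt3, pre4⟩ hcovT
    · exact stampCheck_seven_six_s8_10 c (hmemR c (by simp)) ⟨hlt2, pre3⟩ e (hmemR e (by simp)) ⟨hlt3, pre4⟩ hcovT
    · exact stampCheck_seven_six_s8_11 c (hmemR c (by simp)) ⟨hlt2, pre3⟩ e (hmemR e (by simp)) ⟨hlt3, pre4⟩ hcovT
    · exact stampCheck_seven_six_s8_12 c (hmemR c (by simp)) ⟨hlt2, pre3⟩ e (hmemR e (by simp)) ⟨hlt3, pre4⟩ hcovT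
    · exact stampCheck_seven_six_s8_13 c (hmemR c (by simp)) ⟨hlt2, pre3⟩ e (hmemR e (by simp)) ⟨hlt3, pre4⟩ hcovT
    · exact stampCheck_seven_six_s8_14 c (hmemR c (by simp)) ⟨hlt2, pre3⟩ e (hmemR e (by simp)) ⟨hlt3, pre4⟩ hcovT
    · exact stampCheck_seven_six_s8_15 c (hmemR c (by simp)) ⟨hlt2, pre3⟩ e (hmemR e (by simp)) ⟨hlt3, pre4⟩ hcovT

end Summit.ValiantsHypothesis.ValiantsHypothesis.Theorems.LacunarySymmetroidMatrixDescartes.FiniteSector
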